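import Literature.Algebra.EuclideanLattices.SmoothingGaussianFourier
import Mathlib.Analysis.Calculus.SmoothSeries
import Mathlib.Analysis.SpecialFunctions.ExpDeriv
import Mathlib.Analysis.SpecialFunctions.Trigonometric.Deriv
import Mathlib.Analysis.InnerProductSpace.Calculus
import HarnessLib

/-!
# Differentiating the shifted Poisson identity: Poisson formulas for the first two moments of `D_{Λ,s,c}`

Topic `Algebra/EuclideanLattices` (family `pqc`), sequel of `SmoothingGaussianFourier.lean`; serves the
decomposition of Micciancio–Regev 2007, Thm. 5.23
(`Literature.Computability.Cryptography.MicciancioRegev2007_gapCVP'_to_SIS'`), whose NO-case analysis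
(eqs. (19)–(20), authors' version p. 31) uses **MR07 Lemma 4.2** (directional first and second moments
of `D_{Λ,s,c}` for `s ≥ 2η_ε(Λ)`). MR07 prove Lemma 4.2 by Poisson summation applied to
`gⱼ(x) = (x₁ - c₁)ʲ ρ_c(x)`, whose Fourier transforms are derivatives of `ρ̂_c` (eqs. (7)–(10), pp. 13–14).
This file obtains the same two "moment Poisson formulas" by differentiating the tree's shifted Poisson
identity `∑_{x ∈ L} ρ_s(x - c - tu) = vol(L)⁻¹ sⁿ ∑_{y ∈ L*} ρ_{1/s}(y) cos(2π⟪c + tu, y⟫)`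
(`tsum_gaussianFunction_sub_eq`, `GaussianLatticeSums.lean`) once and twice in the shift parameter `t`
(termwise differentiation of both series, Mathlib `hasDerivAt_tsum_of_isPreconnected`, and uniqueness
of derivatives). Everything here is PROVED; theorems only.

## Results (this file: the primal side; `0 < s`, `x c u ∈ V`, full-rank `L`)

* `hasDerivAt_gaussianFunction_sub_add_smul`, `hasDerivAt_deriv_gaussianFunction_sub_add_smul` — the
  `t`-derivatives of `ρ_s(x - (c + tu))`: `(2π/s²)⟪x - (c + tu), u⟫ρ` and
  `((2π/s²)²⟪x - (c + tu), u⟫² - (2π/s²)‖u‖²)ρ`.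
* `gaussianFunction_sub_add_smul_le`, `summable_one_add_norm_rpow_neg`,
  `summable_of_le_mul_one_add_norm_rpow` — local decay `ρ_s(x - (c + tu)) = O((1 + ‖x‖)⁻ᵇ)` uniformly
  in `|t| < 1`, and summability of `(1 + ‖z‖)⁻ᵇ`, `b > n`, over a full lattice.
* `hasDerivAt_tsum_gaussianFunction_sub_add_smul`, `hasDerivAt_tsum_deriv_gaussianFunction_sub_add_smul`
  — termwise differentiation (once and twice) of the primal series `t ↦ ∑_{x ∈ L} ρ_s(x - (c + tu))` on
  `|t| < 1`.

The dual side and the two moment Poisson formulas (`∑_{x ∈ L} ⟪x - c, u⟫ ρ_s(x - c) =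
-s² K ∑_{y ∈ L*} ρ_{1/s}(y) ⟪u, y⟫ sin(2π⟪c, y⟫)` and its second-order analogue, `K = vol(L)⁻¹ sⁿ`) are
in the sequel `SmoothingGaussianMomentFormulas.lean`; the bounds of Lemma 4.2 proper in
`SmoothingGaussianMoments.lean`.

## References

* D. Micciancio, O. Regev, *Worst-case to average-case reductions based on Gaussian measures*,
  SIAM J. Comput. 37 (2007) 267–302, Lemma 4.2 and its proof, eqs. (7)–(10) (authors' version
  pp. 13–14).
-/

noncomputable section

open MeasureTheory Module Metric Filter Set
open scoped Real ENNReal InnerProductSpace Topology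

namespace Literature.Algebra.EuclideanLattices

variable {V : Type*} [NormedAddCommGroup V] [InnerProductSpace ℝ V]

/-! ### Termwise calculus: the primal Gaussian term -/

/-- The `t`-derivative of the shifted Gaussian `t ↦ ρ_s(x - (c + tu))` is
`(2π/s²) ⟪x - (c + tu), u⟫ ρ_s(x - (c + tu))` (chain rule on `exp(-π‖·‖²/s²)`).
[cite: MicciancioRegev2007, Lemma 4.2 (proof, eq. (8), p. 13)] -/
theorem hasDerivAt_gaussianFunction_sub_add_smul (s : ℝ) (x c u : V) (t : ℝ) :
    HasDerivAt (fun t : ℝ ↦ gaussianFunction s (x - (c + t • u)))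
      (2 * π / s ^ 2 * ⟪x - (c + t • u), u⟫_ℝ * gaussianFunction s (x - (c + t • u))) t := by
  have h1 : HasDerivAt (fun t : ℝ ↦ x - (c + t • u)) (-u) t := by
    simpa using (((hasDerivAt_id t).smul_const u).const_add c).const_sub x
  have h3 := (h1.norm_sq.const_mul (-π / s ^ 2)).exp
  have hfun : (fun t : ℝ ↦ gaussianFunction s (x - (c + t • u))) =
      fun t : ℝ ↦ Real.exp (-π / s ^ 2 * (‖(fun t : ℝ ↦ x - (c + t • u)) ·‖ ^ 2) t) := by
    funext t
    simp only [gaussianFunction]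
    congr 1
    ring
  rw [hfun]
  convert h3 using 1
  simp only [gaussianFunction, inner_neg_right]
  rw [show -π * ‖x - (c + t • u)‖ ^ 2 / s ^ 2 = -π / s ^ 2 * ‖x - (c + t • u)‖ ^ 2 by ring]
  ring

/-- The second `t`-derivative of `t ↦ ρ_s(x - (c + tu))`:
`d/dt [(2π/s²)⟪x - (c+tu), u⟫ ρ] = ((2π/s²)² ⟪x - (c+tu), u⟫² - (2π/s²)‖u‖²) ρ`.
[cite: MicciancioRegev2007, Lemma 4.2 (proof, eq. (8), p. 13)] -/
theorem hasDerivAt_deriv_gaussianFunction_sub_add_smul (s : ℝ) (x c u : V) (t : ℝ) :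
    HasDerivAt (fun t : ℝ ↦ 2 * π / s ^ 2 * ⟪x - (c + t • u), u⟫_ℝ * gaussianFunction s (x - (c + t • u)))
      (((2 * π / s ^ 2) ^ 2 * ⟪x - (c + t • u), u⟫_ℝ ^ 2 - 2 * π / s ^ 2 * ‖u‖ ^ 2) *
        gaussianFunction s (x - (c + t • u))) t := by
  have h1 : HasDerivAt (fun t : ℝ ↦ x - (c + t • u)) (-u) t := by
    simpa using (((hasDerivAt_id t).smul_const u).const_add c).const_sub x
  have hinner : HasDerivAt (fun t : ℝ ↦ ⟪x - (c + t • u), u⟫_ℝ) (-‖u‖ ^ 2) t := by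
    have := h1.inner ℝ (hasDerivAt_const t u)
    simpa [inner_neg_left, real_inner_self_eq_norm_sq] using this
  have hρ := hasDerivAt_gaussianFunction_sub_add_smul s x c u t
  have h := (hinner.mul hρ).const_mul (2 * π / s ^ 2)
  have hfun : (fun t : ℝ ↦ 2 * π / s ^ 2 * ⟪x - (c + t • u), u⟫_ℝ * gaussianFunction s (x - (c + t • u))) =
      fun t : ℝ ↦ 2 * π / s ^ 2 * (⟪x - (c + t • u), u⟫_ℝ * gaussianFunction s (x - (c + t • u))) := by
    funext t; ring
  rw [hfun]
  refine h.congr_deriv ?_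
  ring

/-- `‖c + tu‖ ≤ ‖c‖ + ‖u‖` for `|t| < 1`. [folklore] -/
theorem norm_add_smul_le_of_abs_lt_one (c u : V) {t : ℝ} (ht : t ∈ Ioo (-1 : ℝ) 1) :
    ‖c + t • u‖ ≤ ‖c‖ + ‖u‖ := by
  have h : ‖t • u‖ ≤ ‖u‖ := by
    rw [norm_smul, Real.norm_eq_abs]
    exact mul_le_of_le_one_left (norm_nonneg _) (abs_le.2 ⟨ht.1.le, ht.2.le⟩)
  calc ‖c + t • u‖ ≤ ‖c‖ + ‖t • u‖ := norm_add_le _ _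
    _ ≤ ‖c‖ + ‖u‖ := by linarith

/-- `‖x - (c + tu)‖ ≤ (1 + ‖x‖)(1 + ‖c‖ + ‖u‖)` for `|t| < 1`. [folklore] -/
theorem norm_sub_add_smul_le (x c u : V) {t : ℝ} (ht : t ∈ Ioo (-1 : ℝ) 1) :
    ‖x - (c + t • u)‖ ≤ (1 + ‖x‖) * (1 + ‖c‖ + ‖u‖) := by
  have h := norm_add_smul_le_of_abs_lt_one c u ht
  calc ‖x - (c + t • u)‖ ≤ ‖x‖ + ‖c + t • u‖ := norm_sub_le _ _
    _ ≤ ‖x‖ + (‖c‖ + ‖u‖) := by gcongr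
    _ ≤ (1 + ‖x‖) * (1 + ‖c‖ + ‖u‖) := by nlinarith [norm_nonneg x, norm_nonneg c, norm_nonneg u]

/-- **Local decay of the shifted Gaussian in the lattice variable, uniformly in `|t| < 1`**:
`ρ_s(x - (c + tu)) ≤ e^{b²s²/(4π)} (1 + ‖c‖ + ‖u‖)ᵇ (1 + ‖x‖)⁻ᵇ` for `b ≥ 0`
(`norm_coe_gaussianFunction_sub_le` at the centre `c + tu`). [folklore] -/
theorem gaussianFunction_sub_add_smul_le {s : ℝ} (hs : 0 < s) (x c u : V) {b : ℝ} (hb : 0 ≤ b) {t : ℝ}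
    (ht : t ∈ Ioo (-1 : ℝ) 1) :
    gaussianFunction s (x - (c + t • u)) ≤
      Real.exp (b ^ 2 / (4 * (π / s ^ 2))) * (1 + ‖c‖ + ‖u‖) ^ b * (1 + ‖x‖) ^ (-b) := by
  have h := norm_coe_gaussianFunction_sub_le hs (c + t • u) hb x
  rw [Complex.norm_real, Real.norm_eq_abs, abs_of_pos (gaussianFunction_pos _ _)] at h
  refine h.trans ?_
  have h1 : 1 + ‖c + t • u‖ ≤ 1 + ‖c‖ + ‖u‖ := by
    have := norm_add_smul_le_of_abs_lt_one c u ht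
    linarith
  have h2 : (1 + ‖c + t • u‖) ^ b ≤ (1 + ‖c‖ + ‖u‖) ^ b := Real.rpow_le_rpow (by positivity) h1 hb
  have h3 : 0 ≤ (1 + ‖x‖) ^ (-b) := Real.rpow_nonneg (by positivity) _
  exact mul_le_mul_of_nonneg_right (mul_le_mul_of_nonneg_left h2 (by positivity)) h3

/-! ### Summability over lattices of polynomially weighted decay -/

section Summable

variable [FiniteDimensional ℝ V] (Λ : Submodule ℤ V) [DiscreteTopology Λ] [IsZLattice ℝ Λ]

/-- `∑_{z ∈ Λ} (1 + ‖z‖)⁻ᵇ` converges for `b > n` and a full lattice `Λ` (Mathlib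
`ZLattice.summable_norm_rpow`). [folklore] -/
theorem summable_one_add_norm_rpow_neg {b : ℝ} (hb : (finrank ℝ V : ℝ) < b) :
    Summable fun z : Λ ↦ (1 + ‖(z : V)‖) ^ (-b) := by
  have hrank : -b < -(Module.finrank ℤ Λ : ℝ) := by rw [ZLattice.rank ℝ Λ]; linarith
  have hb0 : 0 < b := lt_of_le_of_lt (Nat.cast_nonneg _) hb
  refine Summable.of_norm_bounded_eventually (ZLattice.summable_norm_rpow Λ (-b) hrank) ?_
  refine Filter.eventually_cofinite.mpr ((Set.finite_singleton (0 : Λ)).subset fun z hz ↦ ?_)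
  rw [Set.mem_singleton_iff]
  by_contra h0
  refine hz ?_
  rw [Real.norm_eq_abs, abs_of_nonneg (Real.rpow_nonneg (by positivity) _)]
  have hz0 : 0 < ‖(z : V)‖ := norm_pos_iff.2 (by simpa using h0)
  change (1 + ‖(z : V)‖) ^ (-b) ≤ ‖z‖ ^ (-b)
  rw [Real.rpow_neg (by positivity), Real.rpow_neg (norm_nonneg _)]
  refine inv_anti₀ (Real.rpow_pos_of_pos hz0 _) ?_
  exact Real.rpow_le_rpow (norm_nonneg _) (by simp) hb0.le

/-- A function on a full lattice bounded by `C (1 + ‖z‖)ᵏ⁻ᵇ` with `b - k > n` is summable. [folklore] -/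
theorem summable_of_le_mul_one_add_norm_rpow {f : Λ → ℝ} {C b : ℝ} (hb : (finrank ℝ V : ℝ) < b)
    (hf0 : ∀ z, 0 ≤ f z) (hf : ∀ z, f z ≤ C * (1 + ‖(z : V)‖) ^ (-b)) : Summable f :=
  Summable.of_nonneg_of_le hf0 hf ((summable_one_add_norm_rpow_neg Λ hb).mul_left C)

end Summable

/-! ### The two series and their termwise derivatives -/

section Series

variable [FiniteDimensional ℝ V] [MeasurableSpace V] [BorelSpace V]
variable (L : Submodule ℤ V) [DiscreteTopology L] [IsZLattice ℝ L]

omit [MeasurableSpace V] [BorelSpace V] in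
/-- **Termwise differentiation of the primal series**: for `|t| < 1`,
`d/dt ∑_{x ∈ L} ρ_s(x - (c + tu)) = ∑_{x ∈ L} (2π/s²)⟪x - (c + tu), u⟫ ρ_s(x - (c + tu))`
(dominated termwise differentiation: the derivatives are `O((1 + ‖x‖)^{1-b})` uniformly in `|t| < 1`).
[cite: MicciancioRegev2007, Lemma 4.2 (proof, pp. 13–14)] -/
theorem hasDerivAt_tsum_gaussianFunction_sub_add_smul {s : ℝ} (hs : 0 < s) (c u : V) {t : ℝ}
    (ht : t ∈ Ioo (-1 : ℝ) 1) :
    HasDerivAt (fun t : ℝ ↦ ∑' x : L, gaussianFunction s ((x : V) - (c + t • u)))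
      (∑' x : L, 2 * π / s ^ 2 * ⟪(x : V) - (c + t • u), u⟫_ℝ * gaussianFunction s ((x : V) - (c + t • u))) t := by
  set b : ℝ := (finrank ℝ V : ℝ) + 2 with hb
  have hb0 : 0 ≤ b := by positivity
  set A : ℝ := 2 * π / s ^ 2 * ‖u‖ * (1 + ‖c‖ + ‖u‖) * (Real.exp (b ^ 2 / (4 * (π / s ^ 2))) * (1 + ‖c‖ + ‖u‖) ^ b)
    with hA
  have hA0 : 0 ≤ A := by positivity
  -- the dominating sequence `A (1 + ‖x‖)^{1-b}`
  have hsum : Summable fun x : L ↦ A * (1 + ‖(x : V)‖) ^ (-(b - 1)) :=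
    (summable_one_add_norm_rpow_neg L (by rw [hb]; linarith)).mul_left A
  refine hasDerivAt_tsum_of_isPreconnected hsum isOpen_Ioo isPreconnected_Ioo
    (fun x t _ ↦ hasDerivAt_gaussianFunction_sub_add_smul s (x : V) c u t) (fun x t ht' ↦ ?_) (by simp : (0 : ℝ) ∈ Ioo (-1 : ℝ) 1)
    ?_ ht
  · -- the bound on the derivative
    have hρ := gaussianFunction_sub_add_smul_le hs (x : V) c u hb0 ht'
    have hv := norm_sub_add_smul_le (x : V) c u ht'
    have hin : |⟪(x : V) - (c + t • u), u⟫_ℝ| ≤ (1 + ‖(x : V)‖) * (1 + ‖c‖ + ‖u‖) * ‖u‖ :=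
      (abs_real_inner_le_norm _ _).trans (mul_le_mul_of_nonneg_right hv (norm_nonneg _))
    rw [Real.norm_eq_abs, abs_mul, abs_mul, abs_of_pos (gaussianFunction_pos _ _),
      abs_of_nonneg (by positivity : (0 : ℝ) ≤ 2 * π / s ^ 2)]
    have hx1 : 0 < 1 + ‖(x : V)‖ := by positivity
    calc 2 * π / s ^ 2 * |⟪(x : V) - (c + t • u), u⟫_ℝ| * gaussianFunction s ((x : V) - (c + t • u))
        ≤ 2 * π / s ^ 2 * ((1 + ‖(x : V)‖) * (1 + ‖c‖ + ‖u‖) * ‖u‖) *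
          (Real.exp (b ^ 2 / (4 * (π / s ^ 2))) * (1 + ‖c‖ + ‖u‖) ^ b * (1 + ‖(x : V)‖) ^ (-b)) :=
          mul_le_mul (mul_le_mul_of_nonneg_left hin (by positivity)) hρ (gaussianFunction_pos _ _).le
            (by positivity)
      _ = A * ((1 + ‖(x : V)‖) * (1 + ‖(x : V)‖) ^ (-b)) := by rw [hA]; ring
      _ = A * (1 + ‖(x : V)‖) ^ (-(b - 1)) := by
          congr 1
          rw [show -(b - 1) = 1 + -b by ring, Real.rpow_add hx1, Real.rpow_one]
  · -- summability at `t = 0`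
    simpa using summable_gaussianFunction_sub L hs.ne' c

omit [MeasurableSpace V] [BorelSpace V] in
/-- **Termwise differentiation of the derived primal series**: for `|t| < 1`,
`d/dt ∑_{x ∈ L} (2π/s²)⟪x - (c+tu), u⟫ ρ_s(x - (c+tu)) = ∑_{x ∈ L} ((2π/s²)²⟪x - (c+tu), u⟫² - (2π/s²)‖u‖²) ρ_s(x - (c+tu))`.
[cite: MicciancioRegev2007, Lemma 4.2 (proof, pp. 13–14)] -/
theorem hasDerivAt_tsum_deriv_gaussianFunction_sub_add_smul {s : ℝ} (hs : 0 < s) (c u : V) {t : ℝ}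
    (ht : t ∈ Ioo (-1 : ℝ) 1) :
    HasDerivAt (fun t : ℝ ↦ ∑' x : L, 2 * π / s ^ 2 * ⟪(x : V) - (c + t • u), u⟫_ℝ * gaussianFunction s ((x : V) - (c + t • u)))
      (∑' x : L, ((2 * π / s ^ 2) ^ 2 * ⟪(x : V) - (c + t • u), u⟫_ℝ ^ 2 - 2 * π / s ^ 2 * ‖u‖ ^ 2) *
        gaussianFunction s ((x : V) - (c + t • u))) t := by
  set b : ℝ := (finrank ℝ V : ℝ) + 3 with hb
  have hb0 : 0 ≤ b := by positivity
  set E : ℝ := Real.exp (b ^ 2 / (4 * (π / s ^ 2))) * (1 + ‖c‖ + ‖u‖) ^ b with hE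
  set A : ℝ := ((2 * π / s ^ 2) ^ 2 * ((1 + ‖c‖ + ‖u‖) * ‖u‖) ^ 2 + 2 * π / s ^ 2 * ‖u‖ ^ 2) * E with hA
  have hsum : Summable fun x : L ↦ A * (1 + ‖(x : V)‖) ^ (-(b - 2)) :=
    (summable_one_add_norm_rpow_neg L (by rw [hb]; linarith)).mul_left A
  -- summability of the derived series at `t = 0` (from the first-derivative bound with exponent `b`)
  have hsum0 : Summable fun x : L ↦ 2 * π / s ^ 2 * ⟪(x : V) - (c + (0 : ℝ) • u), u⟫_ℝ *
      gaussianFunction s ((x : V) - (c + (0 : ℝ) • u)) := by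
    have h0 : (0 : ℝ) ∈ Ioo (-1 : ℝ) 1 := by simp
    refine Summable.of_norm ?_
    refine summable_of_le_mul_one_add_norm_rpow L (C := 2 * π / s ^ 2 * ((1 + ‖c‖ + ‖u‖) * ‖u‖) * E)
      (b := b - 1) (by rw [hb]; linarith) (fun _ ↦ norm_nonneg _) fun x ↦ ?_
    have hρ := gaussianFunction_sub_add_smul_le hs (x : V) c u hb0 h0
    have hv := norm_sub_add_smul_le (x : V) c u h0
    have hin : |⟪(x : V) - (c + (0 : ℝ) • u), u⟫_ℝ| ≤ (1 + ‖(x : V)‖) * (1 + ‖c‖ + ‖u‖) * ‖u‖ :=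
      (abs_real_inner_le_norm _ _).trans (mul_le_mul_of_nonneg_right hv (norm_nonneg _))
    rw [Real.norm_eq_abs, abs_mul, abs_mul, abs_of_pos (gaussianFunction_pos _ _),
      abs_of_nonneg (by positivity : (0 : ℝ) ≤ 2 * π / s ^ 2)]
    have hx1 : 0 < 1 + ‖(x : V)‖ := by positivity
    calc 2 * π / s ^ 2 * |⟪(x : V) - (c + (0 : ℝ) • u), u⟫_ℝ| * gaussianFunction s ((x : V) - (c + (0 : ℝ) • u))
        ≤ 2 * π / s ^ 2 * ((1 + ‖(x : V)‖) * (1 + ‖c‖ + ‖u‖) * ‖u‖) * (E * (1 + ‖(x : V)‖) ^ (-b)) := by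
          rw [hE]
          exact mul_le_mul (mul_le_mul_of_nonneg_left hin (by positivity)) hρ (gaussianFunction_pos _ _).le
            (by positivity)
      _ = 2 * π / s ^ 2 * ((1 + ‖c‖ + ‖u‖) * ‖u‖) * E * ((1 + ‖(x : V)‖) * (1 + ‖(x : V)‖) ^ (-b)) := by ring
      _ = _ := by
          congr 1
          rw [show -(b - 1) = 1 + -b by ring, Real.rpow_add hx1, Real.rpow_one]
  refine hasDerivAt_tsum_of_isPreconnected hsum isOpen_Ioo isPreconnected_Ioo
    (fun x t _ ↦ hasDerivAt_deriv_gaussianFunction_sub_add_smul s (x : V) c u t) (fun x t ht' ↦ ?_)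
    (by simp : (0 : ℝ) ∈ Ioo (-1 : ℝ) 1) hsum0 ht
  -- the bound on the second derivative
  have hρ := gaussianFunction_sub_add_smul_le hs (x : V) c u hb0 ht'
  have hv := norm_sub_add_smul_le (x : V) c u ht'
  have hin : |⟪(x : V) - (c + t • u), u⟫_ℝ| ≤ (1 + ‖(x : V)‖) * ((1 + ‖c‖ + ‖u‖) * ‖u‖) := by
    refine (abs_real_inner_le_norm _ _).trans ?_
    rw [← mul_assoc]
    exact mul_le_mul_of_nonneg_right hv (norm_nonneg _)
  have hx1 : 0 < 1 + ‖(x : V)‖ := by positivity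
  have hx1' : 1 ≤ (1 + ‖(x : V)‖) ^ 2 := one_le_pow₀ (by linarith [norm_nonneg (x : V)])
  rw [Real.norm_eq_abs, abs_mul, abs_of_pos (gaussianFunction_pos _ _)]
  have hcoef : |(2 * π / s ^ 2) ^ 2 * ⟪(x : V) - (c + t • u), u⟫_ℝ ^ 2 - 2 * π / s ^ 2 * ‖u‖ ^ 2| ≤
      ((2 * π / s ^ 2) ^ 2 * ((1 + ‖c‖ + ‖u‖) * ‖u‖) ^ 2 + 2 * π / s ^ 2 * ‖u‖ ^ 2) * (1 + ‖(x : V)‖) ^ 2 := by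
    have hsq : ⟪(x : V) - (c + t • u), u⟫_ℝ ^ 2 ≤ ((1 + ‖(x : V)‖) * ((1 + ‖c‖ + ‖u‖) * ‖u‖)) ^ 2 := by
      rw [← sq_abs]
      exact pow_le_pow_left₀ (abs_nonneg _) hin 2
    have e1 : (2 * π / s ^ 2) ^ 2 * ⟪(x : V) - (c + t • u), u⟫_ℝ ^ 2 ≤
        (2 * π / s ^ 2) ^ 2 * ((1 + ‖c‖ + ‖u‖) * ‖u‖) ^ 2 * (1 + ‖(x : V)‖) ^ 2 :=
      calc (2 * π / s ^ 2) ^ 2 * ⟪(x : V) - (c + t • u), u⟫_ℝ ^ 2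
          ≤ (2 * π / s ^ 2) ^ 2 * ((1 + ‖(x : V)‖) * ((1 + ‖c‖ + ‖u‖) * ‖u‖)) ^ 2 :=
            mul_le_mul_of_nonneg_left hsq (by positivity)
        _ = _ := by ring
    have e2 : 2 * π / s ^ 2 * ‖u‖ ^ 2 ≤ 2 * π / s ^ 2 * ‖u‖ ^ 2 * (1 + ‖(x : V)‖) ^ 2 :=
      le_mul_of_one_le_right (by positivity) hx1'
    calc |(2 * π / s ^ 2) ^ 2 * ⟪(x : V) - (c + t • u), u⟫_ℝ ^ 2 - 2 * π / s ^ 2 * ‖u‖ ^ 2|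
        ≤ |(2 * π / s ^ 2) ^ 2 * ⟪(x : V) - (c + t • u), u⟫_ℝ ^ 2| + |2 * π / s ^ 2 * ‖u‖ ^ 2| := abs_sub _ _
      _ = (2 * π / s ^ 2) ^ 2 * ⟪(x : V) - (c + t • u), u⟫_ℝ ^ 2 + 2 * π / s ^ 2 * ‖u‖ ^ 2 := by
          rw [abs_of_nonneg (by positivity), abs_of_nonneg (by positivity)]
      _ ≤ (2 * π / s ^ 2) ^ 2 * ((1 + ‖c‖ + ‖u‖) * ‖u‖) ^ 2 * (1 + ‖(x : V)‖) ^ 2 +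
            2 * π / s ^ 2 * ‖u‖ ^ 2 * (1 + ‖(x : V)‖) ^ 2 := add_le_add e1 e2
      _ = _ := by ring
  calc |(2 * π / s ^ 2) ^ 2 * ⟪(x : V) - (c + t • u), u⟫_ℝ ^ 2 - 2 * π / s ^ 2 * ‖u‖ ^ 2| *
        gaussianFunction s ((x : V) - (c + t • u))
      ≤ ((2 * π / s ^ 2) ^ 2 * ((1 + ‖c‖ + ‖u‖) * ‖u‖) ^ 2 + 2 * π / s ^ 2 * ‖u‖ ^ 2) * (1 + ‖(x : V)‖) ^ 2 *
          (E * (1 + ‖(x : V)‖) ^ (-b)) := by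
        rw [hE]
        exact mul_le_mul hcoef hρ (gaussianFunction_pos _ _).le (by positivity)
    _ = A * ((1 + ‖(x : V)‖) ^ 2 * (1 + ‖(x : V)‖) ^ (-b)) := by rw [hA]; ring
    _ = A * (1 + ‖(x : V)‖) ^ (-(b - 2)) := by
        congr 1
        rw [show -(b - 2) = 2 + -b by ring, Real.rpow_add hx1, Real.rpow_two]

end Series

end Literature.Algebra.EuclideanLattices

end
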